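import Literature.AlgebraicGeometry.Motives.CubeStepILift
import Literature.AlgebraicGeometry.Motives.CubeStepIFibreClass
import Literature.AlgebraicGeometry.Motives.CubeStepISlice
import Literature.AlgebraicGeometry.Motives.KunnethH1Fibre
import HarnessLib

/-!
# Theorem of the cube, Step (I) of Görtz–Wedhorn II, Lemma 24.72: the discharge

This file proves the named fact `theoremOfCube_trivialAlong_thickeningPt` of
`Motives/TheoremOfCubeThickenings` (Görtz–Wedhorn II, Lemma 24.72, p. 548, proof, Step (I), p. 549,
in the situation of the proof of Thm. 24.73, p. 550): for `X`, `Y` proper geometrically integral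
`K`-schemes with rational points `x`, `y`, `T` a locally noetherian integral `K`-scheme, `D` a
Cartier divisor on `(X × Y) × T` whose class is trivial on `{x} × Y × T` and on `X × {y} × T`, and
`t` a point of the trivial locus `Z(D)`, the line bundle `𝒪(D)` is trivial along every
infinitesimal neighbourhood `(X × Y) ×_K Spec(𝒪_{T,t}/𝔪^{n+1}) → (X × Y) × T` of the fibre over
`t`.

The proof is the printed induction on `n` ("by induction on the length of `A`"), assembled from
the tree:

* `n = 0`: `t ∈ Z(D)` means `𝒪(D)` is trivial on the fibre (`mem_trivialLocus_iff_trivialAlong`,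
  `Motives/CartierDivisorCocycleIntegral`), and `𝒪_{T,t}/𝔪 = κ(t)`;
* `n → n + 1`: in the flat model of a finite affine cover of the fibre
  (`Motives/ThickeningTower`, `…Model`, `…CechModel`) the trivialisation of level
  `A_n = 𝒪_{T,t}/𝔪^{n+1}` lifts along the small extension `A_{n+1} → A_n` (kernel `≅ κ(t)^d`) iff
  its obstruction cocycle `ε ∈ Ž¹(𝒪_{(X × Y)_t})^d` is a coboundary (`Motives/CubeStepILift`);
  its Čech class (`Motives/CubeStepIFibreClass`) dies on the slices `{x} × Y_t`, `X × {y}_t`,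
  where `𝒪(D)` is trivial on the whole slice and the slice trivialisation can be adjusted by a
  constant to match (`Motives/CubeStepISlice`, using (∗) `H⁰(Y × Spec A, 𝒪) = A`, Cor. 24.63 =
  `snd_app_bijective_holds`), hence vanishes by the Künneth injectivity
  `H¹((X × Y)_t, 𝒪) ↪ H¹(Y_t, 𝒪) ⊕ H¹(X_t, 𝒪)` (`Motives/KunnethH1Fibre`, from
  `kunneth_cechH1_slices_injective_holds`).

Also: the tower cover attached to a fibre cover (`FibreCover.toTowerCover`, `g = 𝟙`), the
comparison morphisms `Spec(𝒪_{T,t}/𝔪^{n+1}) → (model base)` and `(model base κ(t)) → Spec κ(t)`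
(identities on the underlying schemes), and the isomorphism `𝒪_{T,t}/𝔪^1 ≅ κ(t)`. No new named
fact; `theoremOfCube_trivialAlong_thickeningPt_holds` discharges the fact.

## References

* U. Görtz, T. Wedhorn, *Algebraic Geometry II: Cohomology of Schemes*, Springer Spektrum (2023),
  doi:10.1007/978-3-658-43031-3: Cor. 24.63, p. 539; Lemma 24.72, p. 548, with its proof: (∗)
  on p. 548, Step (I) on p. 549; Thm. 24.73 and its proof, p. 550 (read via the held copy).
  [GortzWedhorn2023]
* D. Mumford, *Abelian Varieties*, TIFR Studies in Mathematics 5 (1970): §6, theorem of the cube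
  (the same deformation argument). [MumfordAV1970]
-/

universe u

open CategoryTheory CategoryTheory.Limits AlgebraicGeometry MonoidalCategory TopologicalSpace
open CartesianMonoidalCategory TensorProduct Opposite IsLocalRing
open Literature.RingTheory.Flat
open Literature.RingTheory.Flat.IsSmallExtension (mapπ mapρ kerMap)
open Literature.AlgebraicGeometry.Morphisms

noncomputable section

namespace Literature.AlgebraicGeometry.Motives

variable {K : Type u} [Field K]

/-! ### The tower cover of a fibre cover (`g = 𝟙`) -/

namespace FibreCover

variable {T : SchemeOver K} {B : T.left.Opens} {x : B} {P : SchemeOver K} [IsIntegral (P ⊗ T).left]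
  {D : CartierDivisor (P ⊗ T).left}

/-- **The tower cover of a fibre cover**: the same affine opens `V_a ⊆ (P × T) ∩ pr_T⁻¹B`, viewed
as a tower cover for the identity `g = 𝟙 : P × T → P × T` (`Motives/ThickeningCechModel`).
[folklore] -/
def toTowerCover (𝒱 : FibreCover (P := P) x D) : TowerCover x D P (𝟙 (P ⊗ T).left) where
  κ := 𝒱.κ
  V a := (𝒱.V a).U
  chart := 𝒱.chart
  V_le := 𝒱.V_le
  preimage_le a := (𝒱.V a).le
  isAffineOpen a := 𝒱.isAffineOpen a
  covers y hy := 𝒱.covers y hy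

end FibreCover

/-! ### The model bases versus `thickeningPt`, `residuePt` -/

section Bases

variable (T : SchemeOver K) {B : T.left.Opens} (x : B) (hB : IsAffineOpen B)

/-- **`Spec(𝒪_{T,x}/𝔪^{n+1})` as `thickeningPt` maps to the model base `modelPt T hB A_n`** by the
identity of `Spec A_n` (the two `K`-structures agree, `baseSpec_thickRing`). [folklore] -/
def thickeningPtToModelPt (n : ℕ) : thickeningPt T x.1 n ⟶ modelPt T hB (thickRing T x n) :=
  Over.homMk (𝟙 (Spec (.of (thickRing T x n)))) (by
    show 𝟙 _ ≫ baseSpec T hB (thickRing T x n) ≫ T.hom =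
      (Spec.map (CommRingCat.ofHom (Ideal.Quotient.mk
        (maximalIdeal (T.left.presheaf.stalk x.1) ^ (n + 1)))) ≫ T.left.fromSpecStalk x.1) ≫ T.hom
    rw [Category.id_comp, baseSpec_thickRing, thickeningPtι_left])

/-- `thickeningPtToModelPt` is a morphism over `T`. [folklore] -/
@[simp] theorem thickeningPtToModelPt_comp (n : ℕ) :
    thickeningPtToModelPt T x hB n ≫ modelPtι T hB (thickRing T x n) = thickeningPtι T x.1 n := by
  ext : 1
  rw [Over.comp_left]
  show 𝟙 _ ≫ baseSpec T hB (thickRing T x n) = _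
  rw [Category.id_comp, baseSpec_thickRing]

/-- **The model base `modelPt T hB κ(x)` maps to `residuePt T x`** by the identity of `Spec κ(x)`
(`baseSpec_resField`). [folklore] -/
def modelPtToResiduePt : modelPt T hB (resField T x) ⟶ residuePt T x.1 :=
  Over.homMk (𝟙 (Spec (.of (resField T x)))) (by
    show 𝟙 _ ≫ T.left.fromSpecResidueField x.1 ≫ T.hom = baseSpec T hB (resField T x) ≫ T.hom
    rw [Category.id_comp, baseSpec_resField]
    rfl)

/-- `modelPtToResiduePt` is a morphism over `T`. [folklore] -/
@[simp] theorem modelPtToResiduePt_comp :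
    modelPtToResiduePt T x hB ≫ residuePtι T x.1 = modelPtι T hB (resField T x) := by
  ext : 1
  rw [Over.comp_left]
  show 𝟙 _ ≫ T.left.fromSpecResidueField x.1 = baseSpec T hB (resField T x)
  rw [Category.id_comp, baseSpec_resField]

/-- **`𝒪_{T,x}/𝔪^1 ≅ κ(x)`** as `Γ(B)`-algebras (the residue map `ρ_0`, bijective). [folklore] -/
def thickRingZeroEquiv : thickRing T x 0 ≃ₐ[Γ(T.left, B)] resField T x :=
  AlgEquiv.ofBijective (thickρ T x 0) ⟨by
    rw [injective_iff_map_eq_zero]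
    intro a ha
    obtain ⟨r, rfl⟩ := Ideal.Quotient.mk_surjective a
    rw [thickρ_eq_zero_iff] at ha
    exact Ideal.Quotient.eq_zero_iff_mem.2 (by rwa [zero_add, pow_one]), thickρ_surjective T x 0⟩

end Bases

/-! ### Transport of triviality between the bases -/

section Transport

variable {T : SchemeOver K} {B : T.left.Opens} {x : B} (hB : IsAffineOpen B) {P : SchemeOver K}
  {X : Scheme.{u}} [IsIntegral X] {D : CartierDivisor X}

/-- Triviality along `P × (model base A_n) → …` gives triviality along
`P × Spec(𝒪_{T,x}/𝔪^{n+1}) → …` (`thickeningPtι`). [folklore] -/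
theorem trivialAlong_thickeningPt_of_modelPt {g : (P ⊗ T).left ⟶ X} (n : ℕ)
    (h : D.TrivialAlong ((P ◁ modelPtι T hB (thickRing T x n)).left ≫ g)) :
    D.TrivialAlong ((P ◁ thickeningPtι T x.1 n).left ≫ g) := by
  have h' := h.comp (P ◁ thickeningPtToModelPt T x hB n).left
  rwa [← Category.assoc, ← Over.comp_left, ← MonoidalCategory.whiskerLeft_comp,
    thickeningPtToModelPt_comp] at h'

/-- Triviality along the fibre `P × Spec κ(x) → P × T` (`residuePtι`) gives triviality along
`P × (model base κ(x)) → P × T`. [folklore] -/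
theorem trivialAlong_modelPt_of_residuePt {g : (P ⊗ T).left ⟶ X}
    (h : D.TrivialAlong ((P ◁ residuePtι T x.1).left ≫ g)) :
    D.TrivialAlong ((P ◁ modelPtι T hB (resField T x)).left ≫ g) := by
  have h' := h.comp (P ◁ modelPtToResiduePt T x hB).left
  rwa [← Category.assoc, ← Over.comp_left, ← MonoidalCategory.whiskerLeft_comp,
    modelPtToResiduePt_comp] at h'

end Transport

namespace TowerCover

variable {T : SchemeOver K} {B : T.left.Opens} {x : B} {X : Scheme.{u}} [IsIntegral X]
  {D : CartierDivisor X} {P : SchemeOver K} {g : (P ⊗ T).left ⟶ X} (𝒲 : TowerCover x D P g)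
  (hB : IsAffineOpen B)

/-- The `ι_R⁻¹W_a` cover `P ×_K Spec R` when `Spec R → T` has image `{x}` (in the form consumed
by `CechTriv.trivialAlong`). [folklore] -/
theorem top_le_iSup_strMap_preimage {R : Type u} [CommRing R] [Algebra Γ(T.left, B) R]
    (hR : ∀ s : Spec (.of R), baseSpec T hB R s = x.1) :
    (⊤ : (P ⊗ modelPt T hB R).left.Opens) ≤ ⨆ a, 𝒲.strMap R hB ⁻¹ᵁ 𝒲.toChartedCover.V a := by
  intro y _
  obtain ⟨a, ha⟩ := 𝒲.covers ((P ◁ modelPtι T hB R).left y)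
    (snd_whiskerLeft_modelPtι_apply T x hB P hR y)
  exact Opens.mem_iSup.2 ⟨a, ha⟩

/-- **A model trivialisation of level `R` trivialises `𝒪(D)` along `P × Spec R → X`.** [folklore] -/
theorem ModelTriv.trivialAlong_strMap {R : Type u} [CommRing R] [Algebra Γ(T.left, B) R]
    (hR : ∀ s : Spec (.of R), baseSpec T hB R s = x.1) (t : 𝒲.ModelTriv R) :
    D.TrivialAlong (𝒲.strMap R hB) :=
  (t.toCechTriv (hB := hB)).trivialAlong (𝒲.top_le_iSup_strMap_preimage hB hR)

/-- **The base case**: a trivialisation of `𝒪(D)` along `P × (model base κ(x)) → X` gives model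
trivialisations of level `κ(x)` and of level `A_0 = 𝒪_{T,x}/𝔪^1 ≅ κ(x)` ("If `A` has length 1,
then `A = κ(s)` and `𝓔|_{X_s}` is trivial since `s ∈ Z`", Görtz–Wedhorn II, proof of Lemma 24.72,
Step (I), p. 549). [cite: GortzWedhorn2023, Lemma 24.72, proof, Step (I) (p. 549)] -/
theorem nonempty_modelTriv_thickRing_zero [IsSeparated P.hom]
    (h : D.TrivialAlong (𝒲.strMap (resField T x) hB)) :
    Nonempty (𝒲.ModelTriv (thickRing T x 0)) :=
  ⟨(ModelTriv.ofCechTriv (CartierDivisor.ChartedCover.CechTriv.ofTrivialization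
    𝒲.toChartedCover h.some)).mapLevel ((thickRingZeroEquiv T x).symm : resField T x →ₐ[Γ(T.left, B)] _)⟩

end TowerCover

namespace TowerCover

/-! ### The induction step -/

section Step

variable {X Y T : SchemeOver K} [IsProper X.hom] [IsProper Y.hom] [GeometricallyIntegral X.hom]
  [GeometricallyIntegral Y.hom] [IsLocallyNoetherian T.left] [IsIntegral ((X ⊗ Y) ⊗ T).left]
  {B : T.left.Opens} {xB : B} (hB : IsAffineOpen B) {D : CartierDivisor ((X ⊗ Y) ⊗ T).left}
  (𝒲 : TowerCover xB D (X ⊗ Y) (𝟙 ((X ⊗ Y) ⊗ T).left))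
  (x : 𝟙_ (SchemeOver K) ⟶ X) (y : 𝟙_ (SchemeOver K) ⟶ Y)

include hB in
/-- **The induction step of Step (I)** (Görtz–Wedhorn II, proof of Lemma 24.72, Step (I), in the
situation of Thm. 24.73): a model trivialisation of `𝒪(D)` of level `A_n = 𝒪_{T,t}/𝔪^{n+1}` on a
tower cover of the fibre of `(X × Y) × T → T` over `t` lifts to level `A_{n+1}`, provided `𝒪(D)`
is trivial along the slices `{x} × Y × T` and `X × {y} × T`. Proof: lift the coordinates
(`Lift.nonempty`); the obstruction cocycle `ε` (`Lift.ε`, a Čech `1`-cocycle of `𝒪` on the fibre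
`(X × Y) × Spec κ(t)`, with `d = dim 𝔪^{n+1}/𝔪^{n+2}` components) restricts on each slice to the
obstruction cocycle of the sliced lifts (`ε_mapSlice`), which is a coboundary because the slice
trivialisation, adjusted by a constant, is an honest lift there
(`exists_modelTriv_mapLevel_eq_mapSlice`, `exists_coboundary_of_modelTriv`); so the Čech class of
each component dies on both slices (`cechComapH1_slice_eq_zero`) and vanishes by the Künneth
injectivity (`kunneth_cechH1_fibre_slices_injective`); a vanishing class is a model coboundary
(`exists_coboundary_of_cechH1_eq_zero`), and correcting the lifts by it gives the trivialisation
of level `A_{n+1}` (`Lift.toModelTriv`).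
[cite: GortzWedhorn2023, Lemma 24.72, proof, Step (I) (p. 549) and proof of Thm. 24.73 (p. 550)] -/
theorem nonempty_modelTriv_succ
    (τx : D.Trivialization ((((λ_ Y).inv ≫ x ▷ Y) ▷ T).left ≫ 𝟙 ((X ⊗ Y) ⊗ T).left))
    (τy : D.Trivialization ((((ρ_ X).inv ≫ X ◁ y) ▷ T).left ≫ 𝟙 ((X ⊗ Y) ⊗ T).left))
    (n : ℕ) (t₀ : 𝒲.ModelTriv (thickRing T xB n)) :
    Nonempty (𝒲.ModelTriv (thickRing T xB (n + 1))) := by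
  -- the small extension `A_{n+1} → A_n` with kernel `κ^d`, and `ρ_{n+1} = ρ_n ∘ π_n`
  have H := thickSmallExtension T xB n
  have hρ := thickρ_comp_thickπ T xB n
  -- lifts of the coordinates
  obtain ⟨L⟩ := ModelTriv.Lift.nonempty H t₀
  -- the adjusted slice trivialisations: honest lifts on the slices
  obtain ⟨σx, hσx⟩ := exists_modelTriv_mapLevel_eq_mapSlice hB ((λ_ Y).inv ≫ x ▷ Y) τx n t₀
  obtain ⟨σy, hσy⟩ := exists_modelTriv_mapLevel_eq_mapSlice hB ((ρ_ X).inv ≫ X ◁ y) τy n t₀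
  have hσx' : ∀ a, mapπ (thickπ T xB n) _ (σx.s a) = (t₀.mapSlice ((λ_ Y).inv ≫ x ▷ Y)).s a :=
    fun a => by rw [← hσx, ModelTriv.mapLevel_s]
  have hσy' : ∀ a, mapπ (thickπ T xB n) _ (σy.s a) = (t₀.mapSlice ((ρ_ X).inv ≫ X ◁ y)).s a :=
    fun a => by rw [← hσy, ModelTriv.mapLevel_s]
  -- hence the sliced obstruction cocycles are coboundaries
  obtain ⟨ηx, hηx⟩ := (L.mapSlice ((λ_ Y).inv ≫ x ▷ Y)).exists_coboundary_of_modelTriv hB H hρ σx hσx'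
  obtain ⟨ηy, hηy⟩ := (L.mapSlice ((ρ_ X).inv ≫ X ◁ y)).exists_coboundary_of_modelTriv hB H hρ σy hσy'
  -- so each component of the obstruction cocycle is a coboundary, by Künneth on the fibre
  have hcob : ∀ ℓ : Fin (thickDim T xB n), ∃ η : ∀ a : 𝒲.κ, 𝒲.C a ⊗[Γ(T.left, B)] resField T xB,
      ∀ a b, L.ε H a b ℓ = ten (resField T xB) (𝒲.rr a b) (η b) - ten (resField T xB) (𝒲.rl a b) (η a) := by
    intro ℓ
    have hz := 𝒲.cechOfModel_mem_cechZ1 hB (resField T xB) (fun a b => L.ε H a b ℓ)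
      (fun a b c => L.ε_cocycle hB H hρ a b c ℓ)
    refine 𝒲.exists_coboundary_of_cechH1_eq_zero hB (resField T xB) _ hz ?_
    refine kunneth_cechH1_fibre_slices_injective (baseSpec T hB (resField T xB) ≫ T.hom) X Y x y
      (𝒲.thickFamily hB (resField T xB)) (𝒲.isAffineOpen_thickFamily hB (resField T xB))
      (𝒲.iSup_thickFamily hB (resField T xB) (baseSpec_resField_apply T xB hB)) _ ?_ ?_
    · exact 𝒲.cechComapH1_slice_eq_zero hB (resField T xB) ((λ_ Y).inv ≫ x ▷ Y) _ hz
        (fun a => ηx a ℓ) fun a b =>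
          (L.ε_mapSlice ((λ_ Y).inv ≫ x ▷ Y) hB H hρ a b ℓ).symm.trans (hηx a b ℓ)
    · exact 𝒲.cechComapH1_slice_eq_zero hB (resField T xB) ((ρ_ X).inv ≫ X ◁ y) _ hz
        (fun a => ηy a ℓ) fun a b =>
          (L.ε_mapSlice ((ρ_ X).inv ≫ X ◁ y) hB H hρ a b ℓ).symm.trans (hηy a b ℓ)
  choose η hη using hcob
  exact ⟨L.toModelTriv H hρ (fun a ℓ => η ℓ a) fun a b ℓ => hη ℓ a b⟩

include hB in
/-- **All levels**: under the hypotheses of Step (I), model trivialisations of every level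
`A_n` exist (induction from the base case `t ∈ Z(D)`). [folklore] -/
theorem nonempty_modelTriv_thickRing
    (τx : D.Trivialization ((((λ_ Y).inv ≫ x ▷ Y) ▷ T).left ≫ 𝟙 ((X ⊗ Y) ⊗ T).left))
    (τy : D.Trivialization ((((ρ_ X).inv ≫ X ◁ y) ▷ T).left ≫ 𝟙 ((X ⊗ Y) ⊗ T).left))
    (h0 : D.TrivialAlong (𝒲.strMap (resField T xB) hB)) (n : ℕ) :
    Nonempty (𝒲.ModelTriv (thickRing T xB n)) := by
  induction n with
  | zero => exact 𝒲.nonempty_modelTriv_thickRing_zero hB h0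
  | succ n ih =>
    obtain ⟨t₀⟩ := ih
    exact 𝒲.nonempty_modelTriv_succ hB x y τx τy n t₀

end Step

end TowerCover

/-! ### The discharge -/

/-- **Theorem of the cube, Step (I)** — the discharge of the named fact
`theoremOfCube_trivialAlong_thickeningPt` of `Motives/TheoremOfCubeThickenings` (Görtz–Wedhorn II,
Lemma 24.72, p. 548, proof, Step (I), p. 549, in the situation of the proof of Thm. 24.73, p. 550): for
`X`, `Y` proper geometrically integral over the field `K` with rational points `x`, `y`, `T` a
locally noetherian integral `K`-scheme, `D` a Cartier divisor on `(X × Y) × T` with trivial class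
on `{x} × Y × T` and on `X × {y} × T`, and `t ∈ Z(D)`, the line bundle `𝒪(D)` is trivial along
`(X × Y) ×_K Spec(𝒪_{T,t}/𝔪^{n+1}) → (X × Y) × T` for every `n`. Proof: choose an affine
neighbourhood `B` of `t` and a finite affine cover of the fibre subordinate to the charts of `D`
(`FibreCover.nonempty`); the slices are closed immersions along which `𝒪(D)` is trivial
(`trivialAlong_iff_classPullback_linEquiv_zero`); run the induction
`nonempty_modelTriv_thickRing` from `t ∈ Z(D)` (`mem_trivialLocus_iff_trivialAlong`); a model
trivialisation of level `A_n` trivialises `𝒪(D)` along `(X × Y) × Spec A_n → (X × Y) × T`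
(`ModelTriv.trivialAlong_strMap`, `trivialAlong_thickeningPt_of_modelPt`).
[cite: GortzWedhorn2023, Lemma 24.72, proof, Step (I) (p. 549) and proof of Thm. 24.73 (p. 550)] -/
theorem theoremOfCube_trivialAlong_thickeningPt_holds : theoremOfCube_trivialAlong_thickeningPt.{u} := by
  intro K _ X Y T _ _ _ _ _ _ _ _ _ x y D hx hy t ht n
  -- an affine neighbourhood `B` of `t`; view `t` as a point `xB` of `B`
  obtain ⟨B, hB, htB, -⟩ := exists_isAffineOpen_mem_and_subset (U := ⊤) (x := t) trivial
  obtain ⟨xB, rfl⟩ : ∃ xB : B, xB.1 = t := ⟨⟨t, htB⟩, rfl⟩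
  -- a finite affine cover of the fibre, as a tower cover
  obtain ⟨𝒱⟩ := FibreCover.nonempty xB hB D (P := X ⊗ Y)
  let 𝒲 : TowerCover xB D (X ⊗ Y) (𝟙 _) := 𝒱.toTowerCover
  -- `𝒪(D)` is trivial along the slices
  have hτx : D.TrivialAlong ((((λ_ Y).inv ≫ x ▷ Y) ▷ T).left ≫ 𝟙 ((X ⊗ Y) ⊗ T).left) := by
    rw [Category.comp_id]
    exact (CartierDivisor.trivialAlong_iff_classPullback_linEquiv_zero _ _).2 hx
  have hτy : D.TrivialAlong ((((ρ_ X).inv ≫ X ◁ y) ▷ T).left ≫ 𝟙 ((X ⊗ Y) ⊗ T).left) := by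
    rw [Category.comp_id]
    exact (CartierDivisor.trivialAlong_iff_classPullback_linEquiv_zero _ _).2 hy
  -- and along the fibre, i.e. along `(X × Y) × (model base κ(t))`
  have h0 : D.TrivialAlong (𝒲.strMap (resField T xB) hB) := by
    have h := trivialAlong_modelPt_of_residuePt hB (g := 𝟙 ((X ⊗ Y) ⊗ T).left)
      (x := xB) (P := X ⊗ Y) (by
        rw [Category.comp_id]
        exact CartierDivisor.mem_trivialLocus_iff_trivialAlong.1 ht)
    exact h
  -- induction over the levels, and back to the scheme
  obtain ⟨tn⟩ := 𝒲.nonempty_modelTriv_thickRing hB x y hτx.some hτy.some h0 n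
  have h1 := tn.trivialAlong_strMap 𝒲 hB (baseSpec_thickRing_apply T xB hB n)
  have h2 := trivialAlong_thickeningPt_of_modelPt hB n h1
  rwa [Category.comp_id] at h2

end Literature.AlgebraicGeometry.Motives

end
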